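import Mathlib
import HarnessLib
import Summits.ValiantsHypothesis.ValiantsHypothesis.Theses.MonotoneRestoration

/-! # Route MonotoneRestoration — crux `MonotoneRestorationQP`, line Sketch, stub N2
(stmt-ValiantsHypothesis-15886)

**Transcendence-degree count.** If `M` complex numbers `c 0, …, c (M-1)` are algebraically
independent over `ℚ` and all lie in the `ℚ`-subalgebra of `ℂ` generated by `r` complex numbers
`a 0, …, a (r-1)`, then `M ≤ r`.

Proof (folklore dimension count, Mathlib's `Algebra.trdeg` API): inside the subalgebra
`S := Algebra.adjoin ℚ (range a)` the lifted family is still algebraically independent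
(`AlgebraicIndependent.of_comp S.val`), so `M ≤ trdeg ℚ S`
(`AlgebraicIndependent.cardinalMk_le_trdeg`); the evaluation map
`MvPolynomial (Fin r) ℚ →ₐ[ℚ] S` is surjective (`Algebra.adjoin_range_eq_range_aeval`), so
`trdeg ℚ S ≤ trdeg ℚ (MvPolynomial (Fin r) ℚ) = r` (`trdeg_le_of_surjective`,
`MvPolynomial.trdeg_of_isDomain`).
-/

noncomputable section

-- `Summit.ValiantsHypothesis.ValiantsHypothesis.…` is the tree's mandated namespace (Sub = Summit).
set_option linter.dupNamespace false

namespace Summit.ValiantsHypothesis.ValiantsHypothesis.Theorems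

open Cardinal in
/-- **N2 — transcendence-degree count** (crux `MonotoneRestorationQP`, line Sketch; registered
stub `stub_card_le_of_algebraicIndependent_adjoin`): a family of `M` complex numbers that is
algebraically independent over `ℚ` and lies in the `ℚ`-subalgebra generated by `r` complex
numbers has `M ≤ r` (`AlgebraicIndependent.cardinalMk_le_trdeg` in the subalgebra,
`trdeg_le_of_surjective` for `MvPolynomial (Fin r) ℚ ↠ adjoin`,
`MvPolynomial.trdeg_of_isDomain`). [folklore] -/
theorem stub_card_le_of_algebraicIndependent_adjoin {M r : ℕ} (a : Fin r → ℂ) (c : Fin M → ℂ)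
    (hc : AlgebraicIndependent ℚ c) (hmem : ∀ i, c i ∈ Algebra.adjoin ℚ (Set.range a)) :
    M ≤ r := by
  set S : Subalgebra ℚ ℂ := Algebra.adjoin ℚ (Set.range a) with hS
  -- (1) lift `c` into the subalgebra `S`; it stays algebraically independent.
  let c' : Fin M → S := fun i => ⟨c i, hmem i⟩
  have hc' : AlgebraicIndependent ℚ c' := AlgebraicIndependent.of_comp S.val hc
  -- (2) hence `M ≤ trdeg ℚ S`.
  have h₁ : (M : Cardinal) ≤ Algebra.trdeg ℚ S := by
    simpa only [mk_fin] using hc'.cardinalMk_le_trdeg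
  -- (3) `S` is a quotient of `MvPolynomial (Fin r) ℚ`, so `trdeg ℚ S ≤ r`.
  let φ : MvPolynomial (Fin r) ℚ →ₐ[ℚ] S :=
    (MvPolynomial.aeval a).codRestrict S fun p => by
      rw [hS, Algebra.adjoin_range_eq_range_aeval]
      exact ⟨p, rfl⟩
  have hφ : Function.Surjective φ := by
    rintro ⟨x, hx⟩
    rw [hS, Algebra.adjoin_range_eq_range_aeval] at hx
    obtain ⟨p, rfl⟩ := hx
    exact ⟨p, rfl⟩
  have h₂ : Algebra.trdeg ℚ S ≤ (r : Cardinal) := by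
    simpa only [MvPolynomial.trdeg_of_isDomain, mk_fin, lift_natCast] using
      trdeg_le_of_surjective φ hφ
  -- (4) conclude.
  exact_mod_cast h₁.trans h₂

end Summit.ValiantsHypothesis.ValiantsHypothesis.Theorems

end
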